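import Summits.Ventures.PercRepro.S2FourteenSevenNuFour
import Summits.Ventures.PercRepro.S2TopSixSeven
import Summits.Ventures.PercRepro.S2TopSixThrough
import Summits.Ventures.PercRepro.S2TwoAvoidingSix
import Summits.Ventures.PercRepro.S2IndepFiveCount
import Summits.Ventures.PercRepro.S2SpreadTail
import Summits.Ventures.PercRepro.S2BasesTriangles

/-!
# PercRepro — S2: THE SPREAD CASE OF THE CELL `(14, 7)` COLOOP-FREE AT `≤ 6` TRIANGLES (p7, gen 14; sub-claim S2)

On a coloop-free core of rank `14` on `21` points with no set of nullity `6` on `≤ 11` points, none of nullity `5` on `≤ 10`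
and none of nullity `4` on `≤ 9` (the SPREAD case of the cell `(14, 7)`), `RLS M 14 5` holds whenever the core carries
`t ≤ 6` triangles (**`c025_fourteen_seven_cf_spread_le_six`**). Per row `t`:
* the top `5`-sets are independent `5`-sets: `≤ C(21, 5) − 153 t + C(t, 2)` (`S2.ncard_indep_five_add_le`);
* the top `6`-sets by their smallest circuit (`S2.ncard_top_six_le_n`): `t · c₃ + 56 · C(17, 2) + 307 · 16 + 924` with
  `c₃ = C(18, 3) = 816`, and at `t = 6` the hitting lever `c₃ = 816 − C(10, 3) = 696` (two distinct circuits of `≤ 4`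
  points avoid every triangle, `S2.exists_two_circuits_le_four_disjoint_of_six`; a top `6`-set meets their union,
  `S2.ncard_top_six_through_add_le`);
* `5 · topCount ≤ 5 · #top5 + 7 · #top6` (`S2.topCount_mul_five_le_seven`);
* the spanning sets: the kit's `Σ_{j ≤ 7} C(21, j) = 198440` at `t ≤ 2`, and `137288` with three triangles
  (`S2.ncard_spanning_add_le_of_three_triangles`) at `t ≥ 3`;
* the rank part of the tail at the caps `(t, 56, 307)` with rank-`5` sets of `≤ 8` points (`ncard_eRk_le_five_le_spread`).
The rows: `(U, S, m) = (39181, 198440, 126), (40171, 198440, 127), (41161, 198440, 128), (42153, 137288, 98),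
(43145, 137288, 99), (44138, 137288, 100), (44125, 137288, 101)` for `t = 0 … 6` (ratios `0.90 … 0.986`).
The rows `7 ≤ t ≤ 11` remain (the lever's charge `816 − C(18 − |D₁ ∪ D₂|, 3)` needs `|D₁ ∪ D₂|` small there).
Axioms: standard.
-/

open scoped Matroid

namespace PercRepro

namespace ThmN

open Set

variable {α : Type}

/-- **The spread case of the coloop-free cell `(14, 7)` at `≤ 6` triangles.** -/
theorem c025_fourteen_seven_cf_spread_le_six (M : Matroid α) [M.Finite]
    (hR : M.eRank = ((14 : ℕ) : ℕ∞)) (hn : M.E.ncard = 14 + 7)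
    (hfree : ∀ e ∈ M.E, ∃ A ⊆ M.E \ {e}, e ∉ M.closure A ∧ e ∉ M.closure ((M.E \ {e}) \ A)) (hK : ∀ e, ¬ M.IsColoop e)
    (h4 : ¬ ∃ W ⊆ M.E, W.ncard ≤ 9 ∧ W.encard = M.eRk W + 4)
    (ht6 : {C : Set α | M.IsCircuit C ∧ C.ncard = 3}.ncard ≤ 6) : RLS M 14 5 := by
  classical
  have hd : M.E.encard = M.eRank + ((7 : ℕ) : ℕ∞) := by
    rw [hR, ← M.ground_finite.cast_ncard_eq, hn]
    push_cast
    ring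
  obtain ⟨-, hs4, hs5⟩ := caps_fourteen_seven_cf M hd hn hfree hK
  have hflat : ∀ X ⊆ M.E, M.eRk X ≤ 5 → X.ncard ≤ 8 := fun X hX hr => by
    have := S2.ncard_le_of_eRk_le_of_not_nullity M 4 9 (by norm_num) h4 hX (r := 5) (by norm_num) (by exact_mod_cast hr)
    omega
  have hflat' : ∀ X ⊆ M.E, M.eRk X ≤ 4 → X.ncard ≤ 7 := fun X hX hr => by
    have := S2.ncard_le_of_eRk_le_of_not_nullity M 4 9 (by norm_num) h4 hX (r := 4) (by norm_num) (by exact_mod_cast hr)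
    omega
  have hEcard : M.ground_finite.toFinset.card = 14 + 7 := by
    rw [← Set.ncard_eq_toFinset_card _ M.ground_finite]; exact hn
  have hL0 : ∀ e ∈ M.E, ¬ M.IsLoop e := not_isLoop_of_free M hfree
  have hs : ∀ e ∈ M.E, ∀ f ∈ M.E, e ≠ f → M.eRk {e, f} = 2 := by
    intro e he f hf hef
    have h2 : (2 : ℕ∞) ≤ M.eRk {e, f} :=
      two_le_eRk_of_two_le_ncard_of_free M hfree (pair_subset he hf) (by rw [ncard_pair hef])
    have h3 : M.eRk {e, f} ≤ 2 := by
      have := M.eRk_le_encard {e, f}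
      rwa [encard_pair hef] at this
    exact le_antisymm h3 h2
  have hC1 : ∀ L ⊆ M.E, M.eRk L = 2 → L.ncard ≤ 3 :=
    fun L hL hr => ncard_le_three_of_eRk_two M hs hfree hL hr
  have hcirc : ∀ C, M.IsCircuit C → 3 ≤ C.encard := three_le_encard_of_circuit M hL0 hs
  have hTfin : {C : Set α | M.IsCircuit C ∧ C.ncard = 3}.Finite :=
    M.ground_finite.finite_subsets.subset (fun C hC => hC.1.subset_ground)
  have h9 : ∀ X ⊆ M.E, X.ncard ≤ 9 → X.encard ≤ M.eRk X + 3 := by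
    intro X hX hX9
    by_contra hlt
    push Not at hlt
    have hk : M.eRk X + 4 ≤ X.encard := by
      have := Order.add_one_le_of_lt hlt
      rwa [add_assoc, show (3 : ℕ∞) + 1 = 4 by norm_num] at this
    obtain ⟨W', hW'X, hW'⟩ := S2.exists_subset_encard_eq_eRk_add M hX 4 hk
    exact h4 ⟨W', hW'X.trans hX, (Set.ncard_le_ncard hW'X (M.ground_finite.subset hX)).trans hX9, hW'⟩
  have hs6 : {C : Set α | M.IsCircuit C ∧ C.ncard = 6}.ncard ≤ (7 + 5).choose 6 :=
    Matroid.ncard_circuits_le_choose_of_encard M hd 5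
  norm_num [Nat.choose] at hs6
  have cellA : ∀ (U S m : ℕ) (A : ℚ), Matroid.topCount M 14 5 ≤ U → {X : Set α | X ⊆ M.E ∧ M.eRk X = M.eRank}.ncard ≤ S → m ≤ 1024 →
      1024 * (U : ℚ) ≤ ((1024 - m : ℕ) : ℚ) * 2 ^ (7 - 5) * (12417 : ℚ) →
      (1024 : ℚ) * (A + (S : ℚ)) ≤ (m : ℚ) * 2 ^ 21 →
      ({X : Set α | X ⊆ M.E ∧ M.eRk X ≤ 5}.ncard : ℚ) ≤ A → RLS M 14 5 := by
    intro U S m A hU hS hm hpoly htail hA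
    rw [RLS_iff]
    exact c025_core_five_cell_of_counts_xqictq5g M 14 7 (by norm_num) hR hn U hU _ hA S hS
      12417 (by norm_num) (phiK 14 5) (by rw [S2.phiK_fourteen_five]; norm_num) ⟨m, hm, hpoly, htail⟩
  -- the top count through the top `5`- and `6`-sets
  have hUsum := S2.topCount_mul_five_le_seven M hR hd hC1 hflat
  -- the top `5`-sets are independent `5`-sets
  have htop5 : {B : Set α | B ⊆ M.E ∧ B.ncard = 5 ∧ M.eRk B = 5 ∧ M.eRk (M.E \ B) = M.eRank}.ncard ≤
      {B : Set α | B ⊆ M.E ∧ B.ncard = 5 ∧ M.eRk B = 5}.ncard :=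
    Set.ncard_le_ncard (fun B hB => ⟨hB.1, hB.2.1, hB.2.2.1⟩)
      (M.ground_finite.finite_subsets.subset (fun B hB => hB.1))
  have hind5 := S2.ncard_indep_five_add_le (M := M) hC1
  rw [hn] at hind5
  norm_num [Nat.choose] at hind5
  -- the top `6`-sets through circuits, with a per-triangle charge `c`
  have htop6_le : ∀ (c : ℕ), (∀ T : Set α, M.IsCircuit T → T.ncard = 3 →
      {B : Set α | B ⊆ M.E ∧ B.ncard = 6 ∧ T ⊆ B ∧ M.eRk (M.E \ B) = M.eRank}.ncard ≤ c) →
      {B : Set α | B ⊆ M.E ∧ B.ncard = 6 ∧ M.eRk B = 5 ∧ M.eRk (M.E \ B) = M.eRank}.ncard ≤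
        {C : Set α | M.IsCircuit C ∧ C.ncard = 3}.ncard * c + 56 * 136 + 307 * 16 + 924 := by
    intro c hc
    have := S2.ncard_top_six_le_n M hn hcirc c hc
    norm_num [Nat.choose] at this
    have h4' := Nat.mul_le_mul_right 136 hs4
    have h5' := Nat.mul_le_mul_right 16 hs5
    omega
  have hc816 : ∀ T : Set α, M.IsCircuit T → T.ncard = 3 →
      {B : Set α | B ⊆ M.E ∧ B.ncard = 6 ∧ T ⊆ B ∧ M.eRk (M.E \ B) = M.eRank}.ncard ≤ 816 := by
    intro T hT hT3
    have hsub : {B : Set α | B ⊆ M.E ∧ B.ncard = 6 ∧ T ⊆ B ∧ M.eRk (M.E \ B) = M.eRank} ⊆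
        {X : Set α | X ⊆ M.E ∧ X.ncard = 6 ∧ T ⊆ X} := fun B hB => ⟨hB.1, hB.2.1, hB.2.2.1⟩
    have h := (Set.ncard_le_ncard hsub (M.ground_finite.finite_subsets.subset (fun X hX => hX.1))).trans
      (S2.ncard_subsets_superset_le M hT.subset_ground 6)
    rw [hn, hT3] at h
    norm_num [Nat.choose] at h
    exact h
  -- the hitting lever at `t = 6`: two distinct circuits of `≤ 4` points avoid `T`, their union has `≤ 8` points
  have hc696 : 6 ≤ {C : Set α | M.IsCircuit C ∧ C.ncard = 3}.ncard → ∀ T : Set α, M.IsCircuit T → T.ncard = 3 →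
      {B : Set α | B ⊆ M.E ∧ B.ncard = 6 ∧ T ⊆ B ∧ M.eRk (M.E \ B) = M.eRank}.ncard ≤ 696 := by
    intro h6 T hT hT3
    obtain ⟨D₁, D₂, hD₁, hD₁4, hd₁, hD₂, hD₂4, hd₂, hne⟩ :=
      S2.exists_two_circuits_le_four_disjoint_of_six M hC1 hs h9 h6 hT hT3
    have h := S2.ncard_top_six_through_add_le M hR hn hT.subset_ground hT3 hD₁ hD₂ hne hd₁ hd₂
    have hZ : (M.E \ T).ncard = 18 := by
      rw [Set.ncard_sdiff hT.subset_ground (M.ground_finite.subset hT.subset_ground), hn, hT3]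
    have hU : D₁ ∪ D₂ ⊆ M.E \ T := by
      rw [Set.union_subset_iff]
      exact ⟨Set.subset_sdiff.2 ⟨hD₁.subset_ground, hd₁⟩, Set.subset_sdiff.2 ⟨hD₂.subset_ground, hd₂⟩⟩
    have hUn : (D₁ ∪ D₂).ncard ≤ 8 := by
      have := Set.ncard_union_le D₁ D₂
      omega
    have hk : 10 ≤ ((M.E \ T) \ (D₁ ∪ D₂)).ncard := by
      rw [Set.ncard_sdiff hU (M.ground_finite.subset (hU.trans Set.sdiff_subset)), hZ]
      omega
    have hch : (10 : ℕ).choose 3 ≤ ((M.E \ T) \ (D₁ ∪ D₂)).ncard.choose 3 := Nat.choose_le_choose 3 hk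
    rw [hZ] at h
    norm_num [Nat.choose] at h hch
    omega
  -- the spanning counts
  have hSkit : {X : Set α | X ⊆ M.E ∧ M.eRk X = M.eRank}.ncard ≤ 198440 := by
    have hS := Matroid.ncard_spanning_le (M := M) hd
    rw [hEcard] at hS
    exact hS.trans (by decide)
  have hspan3 : 3 ≤ {C : Set α | M.IsCircuit C ∧ C.ncard = 3}.ncard → {X : Set α | X ⊆ M.E ∧ M.eRk X = M.eRank}.ncard ≤ 137288 := by
    intro h3
    obtain ⟨T₁, T₂, T₃, hT₁, hT₂, hT₃, h12, h13, h23⟩ := (Set.two_lt_ncard_iff hTfin).1 (by omega)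
    have hS := S2.ncard_spanning_add_le_of_three_triangles M hR hn (by norm_num) hC1 hT₁.1 hT₁.2 hT₂.1 hT₂.2 hT₃.1 hT₃.2 h12 h13 h23
    norm_num [Finset.sum_range_succ, Nat.choose] at hS
    omega
  -- the exact triangle count `t` and the rank part of the tail at `t`
  obtain ⟨t, ht⟩ : ∃ t, {C : Set α | M.IsCircuit C ∧ C.ncard = 3}.ncard = t := ⟨_, rfl⟩
  have hA := ncard_eRk_le_five_le_spread M 14 7 (by norm_num) hR hn hfree hflat hflat' t 56 307 ht.le hs4 hs5
  rw [ht] at ht6 hspan3 htop6_le hind5 hc696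
  have h816 := htop6_le 816 hc816
  by_cases ht2 : t ≤ 2
  · rcases (show t = 0 ∨ t = 1 ∨ t = 2 by omega) with h | h | h
    · subst h
      norm_num [Nat.choose] at hind5 h816
      have hU' : Matroid.topCount M 14 5 ≤ 39181 := by omega
      exact cellA _ 198440 126 _ hU' hSkit (by norm_num) (by norm_num) (by norm_num [Nat.choose]) hA
    · subst h
      norm_num [Nat.choose] at hind5 h816
      have hU' : Matroid.topCount M 14 5 ≤ 40171 := by omega
      exact cellA _ 198440 127 _ hU' hSkit (by norm_num) (by norm_num) (by norm_num [Nat.choose]) hA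
    · subst h
      norm_num [Nat.choose] at hind5 h816
      have hU' : Matroid.topCount M 14 5 ≤ 41161 := by omega
      exact cellA _ 198440 128 _ hU' hSkit (by norm_num) (by norm_num) (by norm_num [Nat.choose]) hA
  push Not at ht2
  have hS' := hspan3 (by omega)
  by_cases ht5 : t ≤ 5
  · rcases (show t = 3 ∨ t = 4 ∨ t = 5 by omega) with h | h | h
    · subst h
      norm_num [Nat.choose] at hind5 h816
      have hU' : Matroid.topCount M 14 5 ≤ 42153 := by omega
      exact cellA _ 137288 98 _ hU' hS' (by norm_num) (by norm_num) (by norm_num [Nat.choose]) hA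
    · subst h
      norm_num [Nat.choose] at hind5 h816
      have hU' : Matroid.topCount M 14 5 ≤ 43145 := by omega
      exact cellA _ 137288 99 _ hU' hS' (by norm_num) (by norm_num) (by norm_num [Nat.choose]) hA
    · subst h
      norm_num [Nat.choose] at hind5 h816
      have hU' : Matroid.topCount M 14 5 ≤ 44138 := by omega
      exact cellA _ 137288 100 _ hU' hS' (by norm_num) (by norm_num) (by norm_num [Nat.choose]) hA
  · have h6e : t = 6 := by omega
    subst h6e
    have h696 := htop6_le 696 (hc696 le_rfl)
    norm_num [Nat.choose] at hind5 h696
    have hU' : Matroid.topCount M 14 5 ≤ 44125 := by omega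
    exact cellA _ 137288 101 _ hU' hS' (by norm_num) (by norm_num) (by norm_num [Nat.choose]) hA

end ThmN

end PercRepro
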